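import Summits.NavierStokesRegularity.NavierStokesRegularity.Theorems.EfficiencyFloorNearSaturationNearMaximiserSeqCoreProfileRegularity
import HarnessLib

/-!
# Route `EfficiencyFloor`, crux `NearSaturationNearMaximiser` (stmt-NavierStokesRegularity-25482) on the
# `ProductionEfficiencyDecay` ladder (stmt-22866): the weak-class limit profile carries `H²` data — its curl has an `L²` gradient

Def-free helper file, twenty-fifth of the group, companion of `…SeqCoreWeakProfile` / `…SeqCoreProfileRegularity`. Along a centred
normalised maximising subsequence the palinstrophy is `1`, so the vorticity gradients `∂ⱼ curl v_{φ₀k}` are bounded in `L²`; their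
weak limits `(N_j)` are the distributional gradient of the algebraic curl `Ω' = Σᵢ eᵢ × M_i` of the weak-limit velocity gradient,
i.e. of `curl w₀` for the weak-class profile `w₀`. Hence `w₀` is (distributionally) divergence free with `∇w₀ ∈ L²` AND
`∇ curl w₀ ∈ L²` — the `H²` datum of the limit profile, in curl form.

* `tendsto_integral_inner_curl_of_gradient` — `curl u_k ⇀ Σᵢ eᵢ × M_i` weakly in `L²` whenever `∂ᵢu_k ⇀ M_i`;
* `exists_weakVorticityGradient` — with `Pal(u_k) ≤ 1`: there are `N_j ∈ L²` with `∫⟪Σᵢ eᵢ × M_i, ∂ⱼψ⟫ = −∫⟪N_j, ψ⟫` on `C¹_c`;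
* `nearSaturationNearMaximiser_of_profileRegularityH2` — BY NAME: stmt-25482 ⟸ (I'-reg-H²) «a weak-class profile `w₀`
  (`(1+|x|)^{-3/2}w₀ ∈ L²`, distributional gradient `(M_j) ∈ L²`, trace free, distributional gradient of its curl `(N_j) ∈ L²`)
  of a centred normalised maximising subsequence agrees a.e. with a `C^∞` field with `D⁰, D¹, D² ∈ L²» — the hypothesis now
  receives every Sobolev-level datum the maximising sequence provides; what it must supply is regularity beyond `H²` and decay.

HONEST FRAMING: (I'-reg-H²) is NOT proved; stmt-25482, `LerayFloorGap`, `ProductionEfficiencyDecay` (stmt-22866) and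
Navier–Stokes regularity stay OPEN; no summit statement is proved. [folklore]
-/

-- the problem directory repeats the summit name (`NavierStokesRegularity/NavierStokesRegularity`)
set_option linter.dupNamespace false

noncomputable section

namespace Summit.NavierStokesRegularity.NavierStokesRegularity.Theorems

namespace NearSaturationNearMaximiser

namespace SeqCore

open Set MeasureTheory Filter Topology Function Real
open scoped InnerProductSpace ENNReal NNReal
open Literature.Analysis.FluidPDE
open Magsanop2026Enstrophy (slice_integrable)

/-! ## §1 The vorticity converges weakly to the algebraic curl of the limit gradient -/

/-- **`curl u_k ⇀ Σⱼ eⱼ × M_j` weakly in `L²`.** Along admissible `u_k` with `∂ⱼu_k ⇀ M_j` weakly in `L²` (against all `L²` fields),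
`∫⟪curl u_k, ψ⟫ → ∫⟪Σⱼ eⱼ × M_j, ψ⟫` for every `ψ ∈ L²` (`⟪curl v, a⟫ = Σⱼ ⟪∂ⱼv, a × eⱼ⟫`). [folklore] -/
theorem tendsto_integral_inner_curl_of_gradient {u : ℕ → EuclideanSpace ℝ (Fin 3) → EuclideanSpace ℝ (Fin 3)}
    (hu : ∀ k, ContDiff ℝ (⊤ : ℕ∞) (u k) ∧ VectorCalculus.IsDivFree (u k) ∧ (∫⁻ x, ‖iteratedFDeriv ℝ 0 (u k) x‖ₑ ^ 2 < ⊤) ∧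
      (∫⁻ x, ‖iteratedFDeriv ℝ 1 (u k) x‖ₑ ^ 2 < ⊤) ∧ (∫⁻ x, ‖iteratedFDeriv ℝ 2 (u k) x‖ₑ ^ 2 < ⊤))
    {M : Fin 3 → EuclideanSpace ℝ (Fin 3) → EuclideanSpace ℝ (Fin 3)} (hM : ∀ j, MemLp (M j) 2 volume)
    (hconv : ∀ (j : Fin 3) (ψ : EuclideanSpace ℝ (Fin 3) → EuclideanSpace ℝ (Fin 3)), MemLp ψ 2 volume →
      Tendsto (fun k => ∫ x, ⟪fderiv ℝ (u k) x (EuclideanSpace.basisFun (Fin 3) ℝ j), ψ x⟫_ℝ) atTop (𝓝 (∫ x, ⟪M j x, ψ x⟫_ℝ)))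
    (ψ : EuclideanSpace ℝ (Fin 3) → EuclideanSpace ℝ (Fin 3)) (hψ : MemLp ψ 2 volume) :
    Tendsto (fun k => ∫ x, ⟪curl (u k) x, ψ x⟫_ℝ) atTop
      (𝓝 (∫ x, ⟪∑ j, cross (EuclideanSpace.basisFun (Fin 3) ℝ j) (M j x), ψ x⟫_ℝ)) := by
  have e2 : ENNReal.ofReal ((2 : ℕ) : ℝ) = 2 := by norm_num
  have hψj : ∀ j, MemLp (fun x => cross (ψ x) (EuclideanSpace.basisFun (Fin 3) ℝ j)) 2 volume := fun j =>
    (crossCLM.flip (EuclideanSpace.basisFun (Fin 3) ℝ j)).comp_memLp' hψ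
  have hD2 : ∀ k j, MemLp (fun x => fderiv ℝ (u k) x (EuclideanSpace.basisFun (Fin 3) ℝ j)) 2 volume := fun k j => by
    have h := (memLp_two_fderiv_apply (hu k).1 (hu k).2.2.2.1 (hu k).2.2.2.2 (e := EuclideanSpace.basisFun (Fin 3) ℝ j) (by simp)).2.2
    rwa [e2] at h
  have Ikj : ∀ k j, Integrable (fun x => ⟪fderiv ℝ (u k) x (EuclideanSpace.basisFun (Fin 3) ℝ j),
      cross (ψ x) (EuclideanSpace.basisFun (Fin 3) ℝ j)⟫_ℝ) := fun k j =>
    integrable_inner_of_memLp holderConjugate_two (by rw [e2]; exact hD2 k j) (by rw [e2]; exact hψj j)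
  have IMj : ∀ j, Integrable (fun x => ⟪M j x, cross (ψ x) (EuclideanSpace.basisFun (Fin 3) ℝ j)⟫_ℝ) := fun j =>
    integrable_inner_of_memLp holderConjugate_two (by rw [e2]; exact hM j) (by rw [e2]; exact hψj j)
  have hsum := tendsto_finsetSum (Finset.univ : Finset (Fin 3)) fun j _ =>
    hconv j (fun x => cross (ψ x) (EuclideanSpace.basisFun (Fin 3) ℝ j)) (hψj j)
  have e1 : ∀ k, (∫ x, ⟪curl (u k) x, ψ x⟫_ℝ) = ∑ j, ∫ x, ⟪fderiv ℝ (u k) x (EuclideanSpace.basisFun (Fin 3) ℝ j),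
      cross (ψ x) (EuclideanSpace.basisFun (Fin 3) ℝ j)⟫_ℝ := fun k => by
    rw [← integral_finsetSum _ (fun j _ => Ikj k j)]
    exact integral_congr_ae (ae_of_all _ fun x => inner_curl_eq_sum_inner_fderiv_cross (u k) x (ψ x))
  have e3 : (∫ x, ⟪∑ j, cross (EuclideanSpace.basisFun (Fin 3) ℝ j) (M j x), ψ x⟫_ℝ) =
      ∑ j, ∫ x, ⟪M j x, cross (ψ x) (EuclideanSpace.basisFun (Fin 3) ℝ j)⟫_ℝ := by
    rw [← integral_finsetSum _ (fun j _ => IMj j)]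
    refine integral_congr_ae (ae_of_all _ fun x => ?_)
    show ⟪∑ j, cross (EuclideanSpace.basisFun (Fin 3) ℝ j) (M j x), ψ x⟫_ℝ =
      ∑ j, ⟪M j x, cross (ψ x) (EuclideanSpace.basisFun (Fin 3) ℝ j)⟫_ℝ
    rw [sum_inner]
    refine Finset.sum_congr rfl fun j _ => ?_
    rw [real_inner_comm, inner_cross_cyclic, inner_cross_cyclic]
  rw [e3]
  exact hsum.congr fun k => (e1 k).symm

/-! ## §2 The curl of the limit gradient has an `L²` gradient -/

/-- **The `H²` datum of the weak-class profile, in curl form.** Along admissible `u_k` with `Pal(u_k) ≤ 1` and `∂ⱼu_k ⇀ M_j` weakly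
in `L²`, there are `N_j ∈ L²(ℝ³; ℝ³)` (`j = 1,2,3`) with `∫⟪Σᵢ eᵢ × M_i, ∂ⱼψ⟫ = −∫⟪N_j, ψ⟫` for all `C¹` compactly supported `ψ`:
the distributional gradient of the algebraic curl of `(M_i)` — of `curl w₀` — lies in `L²`. (Weak limits of the bounded
`∂ⱼ curl u_k` along nested subsequences; integration by parts; `tendsto_integral_inner_curl_of_gradient`.) [folklore] -/
theorem exists_weakVorticityGradient {u : ℕ → EuclideanSpace ℝ (Fin 3) → EuclideanSpace ℝ (Fin 3)}
    (hu : ∀ k, ContDiff ℝ (⊤ : ℕ∞) (u k) ∧ VectorCalculus.IsDivFree (u k) ∧ (∫⁻ x, ‖iteratedFDeriv ℝ 0 (u k) x‖ₑ ^ 2 < ⊤) ∧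
      (∫⁻ x, ‖iteratedFDeriv ℝ 1 (u k) x‖ₑ ^ 2 < ⊤) ∧ (∫⁻ x, ‖iteratedFDeriv ℝ 2 (u k) x‖ₑ ^ 2 < ⊤))
    (hP : ∀ k, ∫ x, frobeniusNormSq (fderiv ℝ (curl (u k)) x) ≤ 1)
    {M : Fin 3 → EuclideanSpace ℝ (Fin 3) → EuclideanSpace ℝ (Fin 3)} (hM : ∀ j, MemLp (M j) 2 volume)
    (hconv : ∀ (j : Fin 3) (ψ : EuclideanSpace ℝ (Fin 3) → EuclideanSpace ℝ (Fin 3)), MemLp ψ 2 volume →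
      Tendsto (fun k => ∫ x, ⟪fderiv ℝ (u k) x (EuclideanSpace.basisFun (Fin 3) ℝ j), ψ x⟫_ℝ) atTop (𝓝 (∫ x, ⟪M j x, ψ x⟫_ℝ))) :
    ∃ N : Fin 3 → EuclideanSpace ℝ (Fin 3) → EuclideanSpace ℝ (Fin 3), (∀ j, MemLp (N j) 2 volume) ∧
      ∀ (j : Fin 3) (ψ : EuclideanSpace ℝ (Fin 3) → EuclideanSpace ℝ (Fin 3)), ContDiff ℝ 1 ψ → HasCompactSupport ψ →
        ∫ x, ⟪∑ i, cross (EuclideanSpace.basisFun (Fin 3) ℝ i) (M i x), fderiv ℝ ψ x (EuclideanSpace.basisFun (Fin 3) ℝ j)⟫_ℝ =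
          -∫ x, ⟪N j x, ψ x⟫_ℝ := by
  have e2 : ENNReal.ofReal ((2 : ℕ) : ℝ) = 2 := by norm_num
  set b := EuclideanSpace.basisFun (Fin 3) ℝ with hb
  -- `∂ⱼ curl u_k` is bounded in `L²` by the palinstrophy
  have hG : ∀ k j, MemLp (fun x => fderiv ℝ (curl (u k)) x (b j)) 2 volume ∧ ∫ x, ‖fderiv ℝ (curl (u k)) x (b j)‖ ^ 2 ≤ 1 := by
    intro k j
    obtain ⟨-, hle, hm⟩ := memLp_two_fderiv_curl_apply (hu k).1 (hu k).2.2.2.1 (hu k).2.2.2.2 j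
    rw [e2] at hm
    exact ⟨hm, hle.trans (hP k)⟩
  -- nested weak limits for `j = 0, 1, 2`
  obtain ⟨N0, hN0, φa, hφa, hla⟩ := exists_weakLimit_memLp_two (f := fun k x => fderiv ℝ (curl (u k)) x (b 0))
    (fun k => (hG k 0).1) (fun k => (hG k 0).2)
  obtain ⟨N1, hN1, φb, hφb, hlb⟩ := exists_weakLimit_memLp_two (f := fun k x => fderiv ℝ (curl (u (φa k))) x (b 1))
    (fun k => (hG (φa k) 1).1) (fun k => (hG (φa k) 1).2)
  obtain ⟨N2, hN2, φc, hφc, hlc⟩ := exists_weakLimit_memLp_two (f := fun k x => fderiv ℝ (curl (u (φa (φb k)))) x (b 2))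
    (fun k => (hG (φa (φb k)) 2).1) (fun k => (hG (φa (φb k)) 2).2)
  set φ : ℕ → ℕ := fun k => φa (φb (φc k)) with hφdef
  have hφ : StrictMono φ := hφa.comp (hφb.comp hφc)
  set N : Fin 3 → EuclideanSpace ℝ (Fin 3) → EuclideanSpace ℝ (Fin 3) := ![N0, N1, N2] with hN
  have hNm : ∀ j, MemLp (N j) 2 volume := fun j => by
    fin_cases j
    · exact hN0
    · exact hN1
    · exact hN2
  have L : ∀ (j : Fin 3) (ψ : EuclideanSpace ℝ (Fin 3) → EuclideanSpace ℝ (Fin 3)), MemLp ψ 2 volume →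
      Tendsto (fun k => ∫ x, ⟪fderiv ℝ (curl (u (φ k))) x (b j), ψ x⟫_ℝ) atTop (𝓝 (∫ x, ⟪N j x, ψ x⟫_ℝ)) := by
    intro j ψ hψ
    fin_cases j
    · exact (hla ψ hψ).comp ((hφb.comp hφc).tendsto_atTop)
    · exact (hlb ψ hψ).comp (hφc.tendsto_atTop)
    · exact hlc ψ hψ
  refine ⟨N, hNm, fun j ψ hψ hψc => ?_⟩
  have hψ2 : MemLp ψ 2 volume := hψ.continuous.memLp_of_hasCompactSupport hψc
  have hDψ2 : MemLp (fun x => fderiv ℝ ψ x (b j)) 2 volume :=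
    ((hψ.continuous_fderiv one_ne_zero).clm_apply continuous_const).memLp_of_hasCompactSupport (hψc.fderiv_apply (𝕜 := ℝ) (b j))
  -- limit 1: weak convergence of the vorticity along `φ`
  have T1 : Tendsto (fun k => ∫ x, ⟪curl (u (φ k)) x, fderiv ℝ ψ x (b j)⟫_ℝ) atTop
      (𝓝 (∫ x, ⟪∑ i, cross (b i) (M i x), fderiv ℝ ψ x (b j)⟫_ℝ)) :=
    tendsto_integral_inner_curl_of_gradient (u := fun k => u (φ k)) (fun k => hu (φ k)) hM
      (fun i ζ hζ => (hconv i ζ hζ).comp hφ.tendsto_atTop) _ hDψ2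
  -- limit 2: integration by parts and the weak limits `N_j`
  have T2 : Tendsto (fun k => ∫ x, ⟪curl (u (φ k)) x, fderiv ℝ ψ x (b j)⟫_ℝ) atTop (𝓝 (-∫ x, ⟪N j x, ψ x⟫_ℝ)) := by
    refine (L j ψ hψ2).neg.congr fun k => ?_
    have hω1 : ContDiff ℝ 1 (curl (u (φ k))) := contDiff_curl (n := 1) ((hu (φ k)).1.of_le (by norm_cast))
    show -(∫ x, ⟪fderiv ℝ (curl (u (φ k))) x (b j), ψ x⟫_ℝ) = ∫ x, ⟪curl (u (φ k)) x, fderiv ℝ ψ x (b j)⟫_ℝ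
    rw [integral_inner_fderiv_apply_const_eq_neg hω1 hψ hψc (b j), neg_neg]
  exact tendsto_nhds_unique T1 T2

/-! ## §3 By name: stmt-25482 from regularity beyond `H²` and decay of the weak-class profile -/

/-- **`NearSaturationNearMaximiser` (stmt-25482) from (I'-reg-H²), BY NAME.** As `nearSaturationNearMaximiser_of_profileRegularity`
(`…SeqCoreProfileRegularity`), but the hypothesis additionally RECEIVES the `H²` datum of the profile: fields `N_j ∈ L²` with
`∫⟪Σᵢ eᵢ × M_i, ∂ⱼψ⟫ = −∫⟪N_j, ψ⟫` on `C¹_c` (the distributional gradient of `curl w₀`; supplied unconditionally by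
`exists_weakVorticityGradient` since `Pal = 1` along the sequence). What (I'-reg-H²) must deliver is only: a weighted-`L²`,
distributionally divergence-free `w₀` with `∇w₀ ∈ L²` and `∇curl w₀ ∈ L²` arising as such a limit agrees a.e. with a `C^∞` field with
`D⁰, D¹, D² ∈ L²` — regularity beyond `H²` and square-integrability of the Lu–Doering extremising profile. NOT proved here. [folklore] -/
theorem nearSaturationNearMaximiser_of_profileRegularityH2
    (HR : ∀ c : ℝ, (0 < c ∧ (∀ v : EuclideanSpace ℝ (Fin 3) → EuclideanSpace ℝ (Fin 3), (ContDiff ℝ (⊤ : ℕ∞) v ∧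
      Literature.Analysis.FluidPDE.VectorCalculus.IsDivFree v ∧ (∫⁻ x, ‖iteratedFDeriv ℝ 0 v x‖ₑ ^ 2 < ⊤) ∧
      (∫⁻ x, ‖iteratedFDeriv ℝ 1 v x‖ₑ ^ 2 < ⊤) ∧ (∫⁻ x, ‖iteratedFDeriv ℝ 2 v x‖ₑ ^ 2 < ⊤)) → (∫ x,
      ⟪Literature.Analysis.FluidPDE.curl v x, fderiv ℝ v x (Literature.Analysis.FluidPDE.curl v x)⟫_ℝ) ≤ c *
      (∫ x, ‖Literature.Analysis.FluidPDE.curl v x‖ ^ 2) ^ (3 / 4 : ℝ) * (∫ x,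
      Literature.Analysis.FluidPDE.frobeniusNormSq (fderiv ℝ (Literature.Analysis.FluidPDE.curl v) x)) ^ (3 / 4 : ℝ)) ∧ ∀ c' : ℝ, (∀ w : EuclideanSpace ℝ (Fin 3) → EuclideanSpace ℝ (Fin 3), (ContDiff ℝ (⊤ : ℕ∞) w ∧
      Literature.Analysis.FluidPDE.VectorCalculus.IsDivFree w ∧ (∫⁻ x, ‖iteratedFDeriv ℝ 0 w x‖ₑ ^ 2 < ⊤) ∧
      (∫⁻ x, ‖iteratedFDeriv ℝ 1 w x‖ₑ ^ 2 < ⊤) ∧ (∫⁻ x, ‖iteratedFDeriv ℝ 2 w x‖ₑ ^ 2 < ⊤)) → (∫ x,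
      ⟪Literature.Analysis.FluidPDE.curl w x, fderiv ℝ w x (Literature.Analysis.FluidPDE.curl w x)⟫_ℝ) ≤ c' *
      (∫ x, ‖Literature.Analysis.FluidPDE.curl w x‖ ^ 2) ^ (3 / 4 : ℝ) * (∫ x,
      Literature.Analysis.FluidPDE.frobeniusNormSq (fderiv ℝ (Literature.Analysis.FluidPDE.curl w) x)) ^ (3 / 4 : ℝ)) → c ≤ c') →
      ∀ K δ : ℝ, 0 < K → 0 < δ → ∀ v : ℕ → EuclideanSpace ℝ (Fin 3) → EuclideanSpace ℝ (Fin 3),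
      (∀ n, (ContDiff ℝ (⊤ : ℕ∞) (v n) ∧
      Literature.Analysis.FluidPDE.VectorCalculus.IsDivFree (v n) ∧ (∫⁻ x, ‖iteratedFDeriv ℝ 0 (v n) x‖ₑ ^ 2 < ⊤) ∧
      (∫⁻ x, ‖iteratedFDeriv ℝ 1 (v n) x‖ₑ ^ 2 < ⊤) ∧ (∫⁻ x, ‖iteratedFDeriv ℝ 2 (v n) x‖ₑ ^ 2 < ⊤))) →
      (∀ n, (∫ x, ‖Literature.Analysis.FluidPDE.curl (v n) x‖ ^ 2) = 1) →
      (∀ n, (∫ x, Literature.Analysis.FluidPDE.frobeniusNormSq (fderiv ℝ (Literature.Analysis.FluidPDE.curl (v n)) x)) = 1) →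
      Tendsto (fun n => ∫ x, ⟪Literature.Analysis.FluidPDE.curl (v n) x, fderiv ℝ (v n) x
        (Literature.Analysis.FluidPDE.curl (v n) x)⟫_ℝ) atTop (𝓝 c) →
      (∀ᶠ n in atTop, δ ≤ ∫ x in Metric.ball (0 : EuclideanSpace ℝ (Fin 3)) K, ‖Literature.Analysis.FluidPDE.curl (v n) x‖ ^ 2) →
      ∀ (φ₀ : ℕ → ℕ) (M : Fin 3 → EuclideanSpace ℝ (Fin 3) → EuclideanSpace ℝ (Fin 3)), StrictMono φ₀ →
      (∀ j, MemLp (M j) 2 volume) →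
      (∀ (j : Fin 3) (ψ : EuclideanSpace ℝ (Fin 3) → EuclideanSpace ℝ (Fin 3)), MemLp ψ 2 volume →
        Tendsto (fun k => ∫ x, ⟪fderiv ℝ (v (φ₀ k)) x (EuclideanSpace.basisFun (Fin 3) ℝ j), ψ x⟫_ℝ) atTop
          (𝓝 (∫ x, ⟪M j x, ψ x⟫_ℝ))) →
      ∀ w₀ : EuclideanSpace ℝ (Fin 3) → EuclideanSpace ℝ (Fin 3), AEStronglyMeasurable w₀ volume →
        MemLp (fun x => ((1 : ℝ) + ‖x‖) ^ (-(3 / 2 : ℝ)) • w₀ x) 2 volume →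
        (∀ (j : Fin 3) (ψ : EuclideanSpace ℝ (Fin 3) → EuclideanSpace ℝ (Fin 3)), ContDiff ℝ 1 ψ → HasCompactSupport ψ →
          ∫ x, ⟪w₀ x, fderiv ℝ ψ x (EuclideanSpace.basisFun (Fin 3) ℝ j)⟫_ℝ = -∫ x, ⟪M j x, ψ x⟫_ℝ) →
        ∀ N : Fin 3 → EuclideanSpace ℝ (Fin 3) → EuclideanSpace ℝ (Fin 3), (∀ j, MemLp (N j) 2 volume) →
        (∀ (j : Fin 3) (ψ : EuclideanSpace ℝ (Fin 3) → EuclideanSpace ℝ (Fin 3)), ContDiff ℝ 1 ψ → HasCompactSupport ψ →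
          ∫ x, ⟪∑ i, cross (EuclideanSpace.basisFun (Fin 3) ℝ i) (M i x), fderiv ℝ ψ x (EuclideanSpace.basisFun (Fin 3) ℝ j)⟫_ℝ =
            -∫ x, ⟪N j x, ψ x⟫_ℝ) →
        ∃ w : EuclideanSpace ℝ (Fin 3) → EuclideanSpace ℝ (Fin 3), ContDiff ℝ (⊤ : ℕ∞) w ∧
          (∫⁻ x, ‖iteratedFDeriv ℝ 0 w x‖ₑ ^ 2 < ⊤) ∧ (∫⁻ x, ‖iteratedFDeriv ℝ 1 w x‖ₑ ^ 2 < ⊤) ∧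
          (∫⁻ x, ‖iteratedFDeriv ℝ 2 w x‖ₑ ^ 2 < ⊤) ∧ w =ᵐ[volume] w₀) :
    Summit.NavierStokesRegularity.NavierStokesRegularity.Theses.EfficiencyFloor.NearSaturationNearMaximiser := by
  refine nearSaturationNearMaximiser_of_profileRegularity
    fun c hsharp K δ hK hδ v hAdm hZ1 hP1 hS hcen φ₀ M hφ₀ hM hconv w₀ hw₀m hw₀2 hprof => ?_
  have hu : ∀ k, ContDiff ℝ (⊤ : ℕ∞) (v (φ₀ k)) ∧ VectorCalculus.IsDivFree (v (φ₀ k)) ∧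
      (∫⁻ x, ‖iteratedFDeriv ℝ 0 (v (φ₀ k)) x‖ₑ ^ 2 < ⊤) ∧ (∫⁻ x, ‖iteratedFDeriv ℝ 1 (v (φ₀ k)) x‖ₑ ^ 2 < ⊤) ∧
      (∫⁻ x, ‖iteratedFDeriv ℝ 2 (v (φ₀ k)) x‖ₑ ^ 2 < ⊤) := fun k => hAdm (φ₀ k)
  have hP : ∀ k, ∫ x, frobeniusNormSq (fderiv ℝ (curl (v (φ₀ k))) x) ≤ 1 := fun k => (hP1 (φ₀ k)).le
  obtain ⟨N, hN, hNid⟩ := exists_weakVorticityGradient (u := fun k => v (φ₀ k)) hu hP hM hconv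
  exact HR c hsharp K δ hK hδ v hAdm hZ1 hP1 hS hcen φ₀ M hφ₀ hM hconv w₀ hw₀m hw₀2 hprof N hN hNid

end SeqCore

end NearSaturationNearMaximiser

end Summit.NavierStokesRegularity.NavierStokesRegularity.Theorems

end
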